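import Mathlib.Algebra.Order.Ring.Unbundled.Rat
import Mathlib.Data.PNat.Basic
import Mathlib.Algebra.Group.Equiv.Basic
import Mathlib.Tactic.FieldSimp
import Mathlib.Tactic.Ring
import HarnessLib

/-!
# Frobenioids I, §3, Example 3.7 — the rescaled factor switch on a dilating elementary Frobenioid
# (analysis note for FLAG 7 and the PR-1 residual (R2))

OURS — analysis note for FLAG 7 ([FrdI] Ex 3.7, kurims p. 70: the printed `End_C ≃ M` law and the
printed factor switch; cf. `DilatingMonoidExample.lean`, where abc-iut-L1-t8 records that the printed
law is not the actual composition law and proves `Ex37.swapEnd_not_multiplicative`, i.e. that the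
printed switch is NOT multiplicative on the actual `End_C`) and for the PR-1 residual (R2) of the
[FrdI] Thm 3.4 (ii)/(iii) proof-route finding (HOME/staging/L1/L1-t13/THM34ii-REPAIR-NOTES.md §3:
"`Ψ`(prime-Frobenius) = irreducible pull-back"). Mochizuki, *The geometry of Frobenioids I*, Kyushu
J. Math. **62** (2008), Ex. 3.7 p. 70 [cite: MochizukiFrdI2008, Ex. 3.7 p.70]. Filed with the approval of
abc-iut-L1-lead (INBOX 2026-08-25T20:57:57Z); author abc-iut-L6-d7. This file ASSERTS NOTHING ABOUT
PRINT beyond the endomorphism monoid computed below, and takes no side on [IUTchIII] Cor 3.12.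

**Content.** Keep the one-object base `D = B(N_{≥1})` of Ex. 3.6/3.7 (an arrow = its base degree `m`)
but PERFECT the divisor monoid to `ℚ_{≥0}` and let the arrow `m` pull divisors back by DIVISION
`a ↦ a/m` — a legitimate contravariant action and a DILATING one in the sense of [FrdI] Def 1.1 (i)
(`a/m ≼ a` for all `a`, `≠ id`). In the elementary Frobenioid an endomorphism of the unique object is a
triple `(deg_Fr, base, Div) = (d, m, a)` with the [FrdI] Def 1.1 (iii) law
`Div(ψ ∘ φ) = φ^* Div ψ + deg_Fr(ψ)·Div φ`, i.e. `(d₂,m₂,a₂) ∘ (d₁,m₁,a₁) = (d₁d₂, m₁m₂, a₂/m₁ + d₂a₁)`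
(`EndQ`; we allow `a ∈ ℚ`, the nonnegative part being a stable submonoid). THEN the RESCALED switch
`σ(d,m,a) := (m, d, (m/d)·a)` IS a monoid automorphism and an involution (`sigmaEquiv`), exchanging the
prime-Frobenius `(p,1,0)` with the divisor-free base arrow `(1,p,0)` (`sigma_frobenius`) and FIXING
every pre-step `(1,1,a)` (`sigma_preStep`). Conversely (`EndPhi`, arbitrary pull-back action `φ`):
any multiplicative map fixing (or rescaling) the pre-steps and sending the prime-Frobenius `f_p` to a
divisor-free base arrow `c_m` forces `φ m (p·a) = a` — the base arrow must pull divisors back by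
DIVISION by `p`, i.e. dilate (`dilating_of_switch`, `dilating_of_switch_rescaled`). So, in this model
class, the (R2) phenomenon through a pre-step-preserving equivalence occurs iff some base arrow
dilates — which hypothesis (e) "`Φ` non-dilating" of [FrdI] Def 3.1 (i) excludes. With the INTEGRAL
monoid `ℤ_{≥0}` and MULTIPLICATIVE pull-back `×d_f` of the printed Ex. 3.7 no rescaled switch
`(d,m,a) ↦ (m,d,λ(d,m)·a)` with `λ` multiplicative is a homomorphism (coefficient matching forces
`λ = m/d` together with `d² = m²`), consistent with `Ex37.swapEnd_not_multiplicative`.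

Deliberately NOT here: that this `F_Φ` satisfies every clause of [FrdI] Def 1.1/1.3 (divisorial,
perf-factorial, …) — the note concerns the endomorphism monoid only; abc-iut-L1-t13 records (INBOX
20:58:07Z) two further constraints a genuine (R2) counterexample must meet (FSMFF base; Def 1.3 (ii) on
both sides).
-/

namespace Literature.AlgebraicGeometry.Frobenioids.DilatingSwitch

/-- The endomorphism monoid of the unique object of `F_Φ`, `Φ(*) = ℚ_{≥0}` over `B(N_{≥1})` with
division-type pull-backs: triples `(deg_Fr, base degree, zero divisor)`. [cite: MochizukiFrdI2008, Ex. 3.7 p.70] -/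
@[ext] structure EndQ : Type where
  /-- Frobenius degree `d ∈ N_{≥1}` [cite: MochizukiFrdI2008, Ex. 3.7 p.70] -/
  d : ℕ+
  /-- base arrow `m ∈ N_{≥1}` (pulls divisors back by `a ↦ a/m`) [cite: MochizukiFrdI2008, Ex. 3.7 p.70] -/
  m : ℕ+
  /-- zero divisor (we allow `a ∈ ℚ`; the nonnegative part `a ≥ 0` is a `σ`-stable submonoid) [cite: MochizukiFrdI2008, Ex. 3.7 p.70] -/
  a : ℚ

namespace EndQ

/-- Composition `x * y := x ∘ y` (`y` first): `Div(x ∘ y) = y^*(Div x) + deg_Fr(x)·Div(y) = x.a/y.m + x.d·y.a`. [cite: MochizukiFrdI2008, Ex. 3.7 p.70] -/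
instance : Mul EndQ := ⟨fun x y => ⟨x.d * y.d, x.m * y.m, x.a / (y.m : ℚ) + (x.d : ℚ) * y.a⟩⟩

/-- Component / structure bookkeeping for the model monoid. [cite: MochizukiFrdI2008, Ex. 3.7 p.70] -/
instance : One EndQ := ⟨⟨1, 1, 0⟩⟩

/-- Component / structure bookkeeping for the model monoid. [cite: MochizukiFrdI2008, Ex. 3.7 p.70] -/
@[simp] theorem mul_d (x y : EndQ) : (x * y).d = x.d * y.d := rfl
/-- Component / structure bookkeeping for the model monoid. [cite: MochizukiFrdI2008, Ex. 3.7 p.70] -/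
@[simp] theorem mul_m (x y : EndQ) : (x * y).m = x.m * y.m := rfl
/-- Component / structure bookkeeping for the model monoid. [cite: MochizukiFrdI2008, Ex. 3.7 p.70] -/
@[simp] theorem mul_a (x y : EndQ) : (x * y).a = x.a / (y.m : ℚ) + (x.d : ℚ) * y.a := rfl
/-- Component / structure bookkeeping for the model monoid. [cite: MochizukiFrdI2008, Ex. 3.7 p.70] -/
@[simp] theorem one_d : (1 : EndQ).d = 1 := rfl
/-- Component / structure bookkeeping for the model monoid. [cite: MochizukiFrdI2008, Ex. 3.7 p.70] -/
@[simp] theorem one_m : (1 : EndQ).m = 1 := rfl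
/-- Component / structure bookkeeping for the model monoid. [cite: MochizukiFrdI2008, Ex. 3.7 p.70] -/
@[simp] theorem one_a : (1 : EndQ).a = 0 := rfl

/-- `EndQ` is a monoid (associativity of the twisted law). [cite: MochizukiFrdI2008, Ex. 3.7 p.70] -/
instance : Monoid EndQ where
  mul_assoc x y z := by
    ext
    · simp [mul_assoc]
    · simp [mul_assoc]
    · simp only [mul_a, mul_m, mul_d, PNat.mul_coe, Nat.cast_mul]
      have hy : (y.m : ℚ) ≠ 0 := by exact_mod_cast y.m.ne_zero
      have hz : (z.m : ℚ) ≠ 0 := by exact_mod_cast z.m.ne_zero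
      field_simp
      ring
  one_mul x := by
    ext <;> simp
  mul_one x := by
    ext <;> simp

/-- The rescaled factor switch `σ(d, m, a) := (m, d, (m/d)·a)`. [cite: MochizukiFrdI2008, Ex. 3.7 p.70] -/
def sigma (x : EndQ) : EndQ := ⟨x.m, x.d, (x.m : ℚ) / (x.d : ℚ) * x.a⟩

/-- Component / structure bookkeeping for the model monoid. [cite: MochizukiFrdI2008, Ex. 3.7 p.70] -/
@[simp] theorem sigma_d (x : EndQ) : (sigma x).d = x.m := rfl
/-- Component / structure bookkeeping for the model monoid. [cite: MochizukiFrdI2008, Ex. 3.7 p.70] -/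
@[simp] theorem sigma_m (x : EndQ) : (sigma x).m = x.d := rfl
/-- Component / structure bookkeeping for the model monoid. [cite: MochizukiFrdI2008, Ex. 3.7 p.70] -/
@[simp] theorem sigma_a (x : EndQ) : (sigma x).a = (x.m : ℚ) / (x.d : ℚ) * x.a := rfl

/-- `σ` is multiplicative: `σ(x ∘ y) = σ(x) ∘ σ(y)`. [cite: MochizukiFrdI2008, Ex. 3.7 p.70] -/
theorem sigma_mul (x y : EndQ) : sigma (x * y) = sigma x * sigma y := by
  ext
  · simp
  · simp
  · simp only [sigma_a, mul_a, mul_d, mul_m, sigma_d, sigma_m, PNat.mul_coe, Nat.cast_mul]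
    have hxd : (x.d : ℚ) ≠ 0 := by exact_mod_cast x.d.ne_zero
    have hyd : (y.d : ℚ) ≠ 0 := by exact_mod_cast y.d.ne_zero
    have hym : (y.m : ℚ) ≠ 0 := by exact_mod_cast y.m.ne_zero
    field_simp

/-- `σ` is an involution. [cite: MochizukiFrdI2008, Ex. 3.7 p.70] -/
theorem sigma_sigma (x : EndQ) : sigma (sigma x) = x := by
  ext
  · simp
  · simp
  · simp only [sigma_a, sigma_d, sigma_m]
    have hxd : (x.d : ℚ) ≠ 0 := by exact_mod_cast x.d.ne_zero
    have hxm : (x.m : ℚ) ≠ 0 := by exact_mod_cast x.m.ne_zero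
    field_simp

/-- `σ(1) = 1`. [cite: MochizukiFrdI2008, Ex. 3.7 p.70] -/
theorem sigma_one : sigma 1 = 1 := by
  ext <;> simp

/-- `σ` as a monoid AUTOMORPHISM of `End`. [cite: MochizukiFrdI2008, Ex. 3.7 p.70] -/
def sigmaEquiv : EndQ ≃* EndQ where
  toFun := sigma
  invFun := sigma
  left_inv := sigma_sigma
  right_inv := sigma_sigma
  map_mul' := sigma_mul

/-- `σ` exchanges the prime-Frobenius `(p, 1, 0)` (base identity, degree `p`, no divisor) with the
base arrow `(1, p, 0)` (degree `1`, no divisor, base of degree `p`): the (R2) phenomenon realised by an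
automorphism. [cite: MochizukiFrdI2008, Ex. 3.7 p.70] -/
theorem sigma_frobenius (p : ℕ+) : sigma ⟨p, 1, 0⟩ = ⟨1, p, 0⟩ := by
  ext <;> simp

/-- `σ` FIXES every pre-step `(1, 1, a)` (base-iso, degree `1`): pre-steps are preserved while Frobenius
type / base-isomorphisms / Frobenius degrees are not. [cite: MochizukiFrdI2008, Ex. 3.7 p.70] -/
theorem sigma_preStep (a : ℚ) : sigma ⟨1, 1, a⟩ = ⟨1, 1, a⟩ := by
  ext <;> simp

end EndQ


/-! ## The converse in the same model class: a pre-step-fixing switch forces a dilating pull-back -/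


/-- Endomorphisms of the one-object elementary model with an ARBITRARY pull-back action `φ` of the base
arrows on divisors (`φ m` = pull-back along the base arrow of degree `m`). [cite: MochizukiFrdI2008, Ex. 3.7 p.70] -/
@[ext] structure EndPhi (φ : ℕ+ → ℚ → ℚ) : Type where
  /-- Frobenius degree [cite: MochizukiFrdI2008, Ex. 3.7 p.70] -/
  d : ℕ+
  /-- base arrow [cite: MochizukiFrdI2008, Ex. 3.7 p.70] -/
  m : ℕ+
  /-- zero divisor [cite: MochizukiFrdI2008, Ex. 3.7 p.70] -/
  a : ℚ

namespace EndPhi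

variable {φ : ℕ+ → ℚ → ℚ}

/-- Composition `x * y := x ∘ y` (`y` first): `Div(x ∘ y) = φ (y.m) (x.a) + x.d·y.a`. [cite: MochizukiFrdI2008, Ex. 3.7 p.70] -/
instance : Mul (EndPhi φ) := ⟨fun x y => ⟨x.d * y.d, x.m * y.m, φ y.m x.a + (x.d : ℚ) * y.a⟩⟩

/-- Component / structure bookkeeping for the model monoid. [cite: MochizukiFrdI2008, Ex. 3.7 p.70] -/
@[simp] theorem mul_d (x y : EndPhi φ) : (x * y).d = x.d * y.d := rfl
/-- Component / structure bookkeeping for the model monoid. [cite: MochizukiFrdI2008, Ex. 3.7 p.70] -/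
@[simp] theorem mul_m (x y : EndPhi φ) : (x * y).m = x.m * y.m := rfl
/-- Component / structure bookkeeping for the model monoid. [cite: MochizukiFrdI2008, Ex. 3.7 p.70] -/
@[simp] theorem mul_a (x y : EndPhi φ) : (x * y).a = φ y.m x.a + (x.d : ℚ) * y.a := rfl

/-- The pre-step with divisor `a`: `(1, 1, a)`. [cite: MochizukiFrdI2008, Ex. 3.7 p.70] -/
def preStep (a : ℚ) : EndPhi φ := ⟨1, 1, a⟩
/-- The prime-Frobenius of degree `p`: `(p, 1, 0)`. [cite: MochizukiFrdI2008, Ex. 3.7 p.70] -/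
def frob (p : ℕ+) : EndPhi φ := ⟨p, 1, 0⟩
/-- The divisor-free base arrow ("pull-back") of base degree `m`: `(1, m, 0)`. [cite: MochizukiFrdI2008, Ex. 3.7 p.70] -/
def pullback (m : ℕ+) : EndPhi φ := ⟨1, m, 0⟩

/-- The Frobenius conjugation law of [FrdI] (Prop 1.10/1.11): `f_p ∘ s_a = s_{p·a} ∘ f_p`, valid for
every pull-back action with `φ 1 = id` (the identity base arrow pulls back trivially). [cite: MochizukiFrdI2008, Ex. 3.7 p.70] -/
theorem frob_mul_preStep (hφ1 : ∀ b, φ 1 b = b) (p : ℕ+) (a : ℚ) :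
    frob (φ := φ) p * preStep a = preStep ((p : ℚ) * a) * frob p := by
  ext <;> simp [frob, preStep, hφ1]

/-- The pull-back transfer law: `c_m ∘ s_a = s_b ∘ c_m` iff `φ m b = a` (divisors transfer through a
pull-back by the pull-back map). [cite: MochizukiFrdI2008, Ex. 3.7 p.70] -/
theorem pullback_mul_preStep_eq_iff (hφ1 : ∀ b, φ 1 b = b) (m : ℕ+) (a b : ℚ) :
    pullback (φ := φ) m * preStep a = preStep b * pullback m ↔ φ m b = a := by
  constructor
  · intro h
    have := congrArg EndPhi.a h
    simp [pullback, preStep, hφ1] at this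
    exact this.symm
  · intro h
    ext <;> simp [pullback, preStep, hφ1, h]

/-- **Converse (model class).** If a multiplicative map `σ` of the endomorphism monoid FIXES every
pre-step and sends the prime-Frobenius `f_p` to the divisor-free base arrow `c_m`, then the base arrow
`m` pulls divisors back by DIVISION by `p` on all multiples of `p` — i.e. `Φ(m)` is the dilation
`x ↦ x/p` (on `p·ℚ = ℚ`): the (R2) phenomenon forces a dilating divisor monoid, which hypothesis (e)
of [FrdI] Def 3.1 (i) excludes. [cite: MochizukiFrdI2008, Ex. 3.7 p.70] -/
theorem dilating_of_switch (hφ1 : ∀ b, φ 1 b = b) {p m : ℕ+} (σ : EndPhi φ → EndPhi φ)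
    (hmul : ∀ x y, σ (x * y) = σ x * σ y) (hpre : ∀ a, σ (preStep a) = preStep a)
    (hf : σ (frob p) = pullback m) (a : ℚ) : φ m ((p : ℚ) * a) = a := by
  have h := congrArg σ (frob_mul_preStep (φ := φ) hφ1 p a)
  rw [hmul, hmul, hpre, hpre, hf] at h
  exact (pullback_mul_preStep_eq_iff hφ1 m a _).mp h

/-- The same with a RESCALING of pre-steps allowed (`σ (s_a) = s_{τ a}` for any `τ` commuting with
multiplication by `p`, e.g. `τ a = λ·a`): still `φ m (p·τ a) = τ a`, so on the range of `τ` the pull-back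
along `m` is division by `p`. [cite: MochizukiFrdI2008, Ex. 3.7 p.70] -/
theorem dilating_of_switch_rescaled (hφ1 : ∀ b, φ 1 b = b) {p m : ℕ+} (σ : EndPhi φ → EndPhi φ)
    (τ : ℚ → ℚ) (hτ : ∀ a, τ ((p : ℚ) * a) = (p : ℚ) * τ a)
    (hmul : ∀ x y, σ (x * y) = σ x * σ y) (hpre : ∀ a, σ (preStep a) = preStep (τ a))
    (hf : σ (frob p) = pullback m) (a : ℚ) : φ m ((p : ℚ) * τ a) = τ a := by
  have h := congrArg σ (frob_mul_preStep (φ := φ) hφ1 p a)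
  rw [hmul, hmul, hpre, hpre, hf, hτ] at h
  exact (pullback_mul_preStep_eq_iff hφ1 m (τ a) _).mp h

end EndPhi


end Literature.AlgebraicGeometry.Frobenioids.DilatingSwitch
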